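import Literature.AnabelianGeometry.SemiGraphs.SpecialFibreTowerOfCharLevels
import HarnessLib

/-!
# The origin statement `Ex310TowerStatement` HOLDS at principal certificates with profinite `Δ`
# ([SemiAnbd] Example 3.10, pp. 44–45 — instance form of FACT-LIST row F-3115, non-vacuously)

Mochizuki, *Semi-graphs of anabelioids*, Publ. RIMS **42** (2006), §3, Example 3.10, manuscript p. 44 l. 9 – p. 45
l. 4 [cite: MochizukiSemiAnbd2006, Ex 3.10 p.44] ("Now suppose that we are given an exhaustive sequence of open
characteristic [hence normal] subgroups of finite index … `⊆ N_i ⊆ … ⊆ Δ` … Then `N_i` determines a finite log étale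
covering … semi-graphs of anabelioids `𝒢_i` … surjections of tempered groups `Δ ↠ … ↠ Δ[i] ↠ … ↠ π₁^temp(𝒢)`") —
typed by seat abc-iut-w5-d122 as the ORIGIN-PARAMETRISED named statement `Ex310TowerStatement (Ω : SpecialFibreOrigin K)`
(`TemperedSpecialFibreTower.lean`; FACT-LIST F-3115, class preparatory; FACT-policy: consumed as a hypothesis
`(h : Ex310TowerStatement Ω)`, asserted for no `Ω`): for THE certified special-fibre data `S` of a curve and ANY such
sequence `N`, a `SpecialFibreTower Δ` with levels `N` lying over `S` (`SpecialFibreTower.LiesOver`, F-3114).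

PROOF-ONLY file (abc-iut cell §4(iii) non-vacuity lane; seat abc-iut-L3-t2 gen 4, owner lineage of the [SemiAnbd] §3
interface; no definition, no instance, no new named fact).  INSTANCE FORM of F-3115, NON-VACUOUSLY:

* `ex310TowerStatement_of_principal` — for EVERY origin `Ω` whose special-fibre certificate is issued only over ONE
  tempered arithmetic group `D₀` (a PRINCIPAL certificate) whose `Π` is profinite and whose `Δ` is infinite,
  `Ex310TowerStatement Ω` HOLDS: by `SpecialFibreTower.exists_of_charLevels` (`SpecialFibreTowerOfCharLevels.lean`) every
  exhaustive sequence of open characteristic normal finite-index subgroups of the slim profinite `Δ` IS the level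
  sequence of a special-fibre tower (one-vertex fibres `B(N_i)`, admissible kernels `1`), which lies over ANY
  special-fibre datum (`admKer i = 1 ≤ Ker`);
* `exists_specialFibreOrigin_ex310TowerStatement_of_slim` — a NON-EMPTY such certificate: over any algebraically
  closed `K` (so `G_K = 1`) and any slim infinite second-countable profinite `P`, the special-fibre SELF-MODEL
  `Π = Δ = P = π₁^temp(B(P))` (seat abc-iut-w4-d098's construction, here at seat abc-iut-L3-t2 gen 3's one-vertex
  semi-graph of anabelioids `OneVertex.graph P` with its explicit chart) with the principal certificate
  `IsSpecialFibreOf := (· , ·) = (D, S)`, `IsOfGeometricOrigin := (· = D)` satisfies `Ex310TowerStatement`;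
  `…_padicAffine` at `P := Aff(ℤ_p)`, and `Ex310TowerStatement.exists_nonvacuous` outright (`K = ℚ̄`, `P = Aff(ℤ_3)`).

HONEST LIMITS: consistency / non-vacuity evidence for the typed statement only — profinite `Δ` (a genuine `Δ^temp_X` is
not), one-vertex fibres, `G_K = 1` at the concrete certificate; NOT André's `π₁^temp` of a curve, NOT the intended
certificate; the universal closure `∀ Ω, Ex310TowerStatement Ω` is neither claimed nor refuted here.  Nothing of the
paper is asserted; no side is taken on [IUTchIII] Cor. 3.12.
-/

noncomputable section

namespace Literature.AnabelianGeometry.SemiGraphs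

open Literature.AlgebraicGeometry.Frobenioids (IsSlimGroup)
open Literature.GroupTheory.SpecificGroups
open ProfiniteSemiGraph Topology

universe u

/-! ### Small facts (private) -/

/-- Open subgroups of slim groups are slim. [cite: MochizukiSemiAnbd2006, §0 p.6] -/
private theorem isSlimGroup_subgroup {G : Type u} [Group G] [TopologicalSpace G] [ContinuousMul G]
    (hG : IsSlimGroup G) (H : Subgroup G) (hH : IsOpen (H : Set G)) : IsSlimGroup H := by
  refine ⟨fun U hU => ?_⟩
  have hUo : IsOpen ((U.map H.subtype : Subgroup G) : Set G) := by
    have : ((U.map H.subtype : Subgroup G) : Set G) = Subtype.val '' (U : Set H) := by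
      ext x; simp
    rw [this]
    exact hH.isOpenMap_subtype_val _ hU
  have hc := hG.centralizer_eq_bot _ hUo
  refine (Subgroup.eq_bot_iff_forall _).mpr fun c hc' => ?_
  have hcG : (c : G) ∈ Subgroup.centralizer ((U.map H.subtype : Subgroup G) : Set G) := by
    rw [Subgroup.mem_centralizer_iff]
    rintro _ ⟨u, hu, rfl⟩
    exact congrArg Subtype.val (Subgroup.mem_centralizer_iff.mp hc' u hu)
  rw [hc] at hcG
  exact Subtype.ext (Subgroup.mem_bot.mp hcG)

/-- Over an algebraically closed field the absolute Galois group is trivial. [folklore] -/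
private theorem subsingleton_absoluteGaloisGroup_of_isAlgClosed (K : Type u) [Field K] [IsAlgClosed K] :
    Subsingleton (Field.absoluteGaloisGroup K) := by
  refine ⟨fun σ τ => AlgEquiv.ext fun x => ?_⟩
  obtain ⟨k, rfl⟩ :=
    (IsAlgClosed.algebraMap_bijective_of_isIntegral (k := K) (K := AlgebraicClosure K)).2 x
  rw [AlgEquiv.commutes, AlgEquiv.commutes]

/-- `Aff(ℤ_p)` is infinite: `[Aff(ℤ_p) : Γ_n] ≥ p^n` is unbounded. [cite: MochizukiSemiAnbd2006, §0 p.6] -/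
private theorem infinite_padicAffine (p : ℕ) [Fact p.Prime] : Infinite (PadicAffine p) := by
  refine ⟨fun hfin => ?_⟩
  have h1 := PadicAffine.pow_le_card_quotient_level (p := p) (Nat.card (PadicAffine p))
  have h2 : Nat.card (PadicAffine p ⧸ PadicAffine.level p (Nat.card (PadicAffine p))) ≤ Nat.card (PadicAffine p) :=
    Nat.card_le_card_of_surjective _ (QuotientGroup.mk_surjective)
  have h3 : Nat.card (PadicAffine p) < p ^ Nat.card (PadicAffine p) :=
    Nat.lt_pow_self (Fact.out : p.Prime).one_lt
  omega

/-! ### `Ex310TowerStatement` at principal certificates with profinite `Δ` -/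

/-- **`Ex310TowerStatement Ω` HOLDS for every origin whose special-fibre certificate is principal at a tempered
arithmetic group `D₀` with profinite `Π` and infinite `Δ`** (instance form of F-3115): for every certified `S` and
EVERY exhaustive sequence `N` of open characteristic normal finite-index subgroups of `Δ` (p. 44 l. 9–11), the slim
profinite `Δ` carries a special-fibre tower with levels `N` (`SpecialFibreTower.exists_of_charLevels`: one-vertex
fibres `B(N_i)`, admissible kernels `1`), which lies over `S`.  Slimness of `Δ` is the interface field
`isSlimGroup_ker`; no origin axiom is used beyond principality. [cite: MochizukiSemiAnbd2006, Ex 3.10 p.44] -/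
theorem ex310TowerStatement_of_principal {K : Type u} [Field K] (Ω : SpecialFibreOrigin K)
    (D₀ : TemperedArithmeticGroup K) (hΩ : ∀ (D : TemperedArithmeticGroup K) (S : SpecialFibreData D),
      Ω.IsSpecialFibreOf D S → D = D₀)
    [CompactSpace D₀.Pi] [TotallyDisconnectedSpace D₀.Pi] (hclosed : IsClosed (D₀.delta : Set D₀.Pi))
    (hinf : Infinite D₀.delta) : Ex310TowerStatement Ω := by
  intro D S hS N hanti hopen hchar hnormal hfi hexh
  obtain rfl := hΩ D S hS
  haveI : CompactSpace D.delta := isCompact_iff_compactSpace.mp hclosed.isCompact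
  haveI : SecondCountableTopology D.Pi := D.secondCountableTopology
  haveI : SecondCountableTopology D.delta := TopologicalSpace.Subtype.secondCountableTopology _
  haveI : Infinite D.delta := hinf
  have hslim : IsSlimGroup D.delta := D.isSlimGroup_ker
  obtain ⟨T, hTN, hadm, -, -⟩ :=
    SpecialFibreTower.exists_of_charLevels hslim N hanti hopen hchar hnormal hfi hexh
  exact ⟨T, hTN, fun i => by rw [hadm i]; exact bot_le⟩

/-! ### A non-empty principal certificate at the special-fibre self-model of a one-vertex semi-graph of anabelioids -/

/-- **A NON-EMPTY principal special-fibre certificate satisfying `Ex310TowerStatement`**: over an algebraically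
closed `K` (`G_K = 1`) and a slim infinite second-countable profinite `P`, the special-fibre SELF-MODEL
`Π = Δ = P` with special-fibre data the one-vertex semi-graph of anabelioids `B(P)` (hypotheses of Thm. 3.7 from
slimness + a level family), its explicit chart `π₁^temp(B(P)) = P` and the identity as admissible quotient, and the
principal origin `Ω` certifying exactly this pair; then `Ω.IsSpecialFibreOf D S`, `Ω.IsOfGeometricOrigin D`, and
`Ex310TowerStatement Ω`.  Consistency evidence only (degenerate arithmetic, one-vertex fibres, profinite `Δ`).
[cite: MochizukiSemiAnbd2006, Ex 3.10 p.44] -/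
theorem exists_specialFibreOrigin_ex310TowerStatement_of_slim (K : Type) [Field K] [IsAlgClosed K]
    (P : Type) [Group P] [TopologicalSpace P] [IsTopologicalGroup P] [CompactSpace P] [TotallyDisconnectedSpace P]
    [SecondCountableTopology P] [Infinite P] (hslim : IsSlimGroup P) :
    ∃ (D : TemperedArithmeticGroup K) (S : SpecialFibreData D) (Ω : SpecialFibreOrigin K),
      Ω.IsSpecialFibreOf D S ∧ Ω.IsOfGeometricOrigin D ∧ Nonempty (P ≃ₜ* D.delta) ∧
        (∀ (D' : TemperedArithmeticGroup K) (S' : SpecialFibreData D'), Ω.IsSpecialFibreOf D' S' ↔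
          (⟨D', S'⟩ : Σ A : TemperedArithmeticGroup K, SpecialFibreData A) = ⟨D, S⟩) ∧
        Ex310TowerStatement Ω := by
  classical
  haveI : Subsingleton (Field.absoluteGaloisGroup K) := subsingleton_absoluteGaloisGroup_of_isAlgClosed K
  have L : ProfiniteSemiGraph.LevelFamily P :=
    Classical.choice (ProfiniteSemiGraph.LevelFamily.nonempty_of_infinite P)
  -- the trivial augmentation `Π = P → G_K = 1`
  let aug : P →ₜ* Field.absoluteGaloisGroup K := { toMonoidHom := 1, continuous_toFun := continuous_const }
  have hker : aug.toMonoidHom.ker = ⊤ := by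
    ext g; simp [aug]
  have hkerClosed : IsClosed ((aug.toMonoidHom.ker : Subgroup P) : Set P) := by
    rw [hker]; exact isClosed_univ
  haveI hkerCpt : CompactSpace (aug.toMonoidHom.ker : Subgroup P) :=
    isCompact_iff_compactSpace.mp hkerClosed.isCompact
  have hΔslim : IsSlimGroup (aug.toMonoidHom.ker : Subgroup P) := by
    rw [hker]; exact isSlimGroup_subgroup hslim ⊤ (by rw [Subgroup.coe_top]; exact isOpen_univ)
  let D : TemperedArithmeticGroup K :=
    { Pi := P
      isTempered := IsTempered.of_profinite
      aug := aug
      aug_surjective := fun g => ⟨1, Subsingleton.elim _ _⟩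
      isTempered_ker := IsTempered.of_profinite
      isSlimGroup := hslim
      isSlimGroup_ker := hΔslim
      secondCountableTopology := inferInstance }
  -- `Δ = Π = P`: the admissible quotient is the inclusion `Δ ↪ P`, an isomorphism
  have hmem : ∀ g : P, g ∈ D.delta := fun g => by
    change g ∈ aug.toMonoidHom.ker
    rw [hker]; exact Subgroup.mem_top g
  let adm : D.delta →ₜ* P :=
    { toMonoidHom := D.delta.subtype, continuous_toFun := continuous_subtype_val }
  let e : P ≃ₜ* D.delta :=
    { toFun := fun g => ⟨g, hmem g⟩
      invFun := fun x => x.1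
      left_inv := fun _ => rfl
      right_inv := fun _ => rfl
      map_mul' := fun _ _ => rfl
      continuous_toFun := continuous_id.subtype_mk _
      continuous_invFun := continuous_subtype_val }
  let S : SpecialFibreData D :=
    { Gc := OneVertex.graph P
      hyp := OneVertex.thm37Hypotheses L hslim
      chart := OneVertex.chart L
      admissible := adm
      admissible_surjective := fun g => ⟨⟨g, hmem g⟩, rfl⟩ }
  let Ω : SpecialFibreOrigin K :=
    { IsOfGeometricOrigin := fun A => A = D
      IsTateOrigin := fun _ => False
      isOfGeometricOrigin_of_isTateOrigin := fun _ h => h.elim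
      IsSpecialFibreOf := fun D' S' => (⟨D', S'⟩ : Σ A : TemperedArithmeticGroup K, SpecialFibreData A) = ⟨D, S⟩
      isOfGeometricOrigin_of_isSpecialFibreOf := fun D' S' h => congrArg Sigma.fst h }
  have hprinc : ∀ (D' : TemperedArithmeticGroup K) (S' : SpecialFibreData D'), Ω.IsSpecialFibreOf D' S' → D' = D :=
    fun D' S' h => congrArg Sigma.fst h
  haveI : CompactSpace D.Pi := (inferInstance : CompactSpace P)
  haveI : TotallyDisconnectedSpace D.Pi := (inferInstance : TotallyDisconnectedSpace P)
  have hclosed : IsClosed (D.delta : Set D.Pi) := hkerClosed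
  have hinf : Infinite D.delta := Infinite.of_injective e e.injective
  exact ⟨D, S, Ω, rfl, rfl, ⟨e⟩, fun _ _ => Iff.rfl,
    ex310TowerStatement_of_principal Ω D hprinc hclosed hinf⟩

/-- **The same at `P := Aff(ℤ_p)`** (slim by seat abc-iut-w5-d212's `PadicAffine.centralizer_eq_bot_of_isOpen`,
infinite, second countable, profinite): a non-empty principal special-fibre certificate over an algebraically closed
`K` satisfying `Ex310TowerStatement`.  Consistency evidence only. [cite: MochizukiSemiAnbd2006, Ex 3.10 p.44] -/
theorem exists_specialFibreOrigin_ex310TowerStatement_padicAffine (K : Type) [Field K] [IsAlgClosed K]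
    (p : ℕ) [Fact p.Prime] :
    ∃ (D : TemperedArithmeticGroup K) (S : SpecialFibreData D) (Ω : SpecialFibreOrigin K),
      Ω.IsSpecialFibreOf D S ∧ Ω.IsOfGeometricOrigin D ∧ Nonempty (PadicAffine p ≃ₜ* D.delta) ∧
        (∀ (D' : TemperedArithmeticGroup K) (S' : SpecialFibreData D'), Ω.IsSpecialFibreOf D' S' ↔
          (⟨D', S'⟩ : Σ A : TemperedArithmeticGroup K, SpecialFibreData A) = ⟨D, S⟩) ∧
        Ex310TowerStatement Ω := by
  haveI : SecondCountableTopology (PadicAffine p) := secondCountableTopology_padicAffine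
  haveI : Infinite (PadicAffine p) := infinite_padicAffine p
  exact exists_specialFibreOrigin_ex310TowerStatement_of_slim K (PadicAffine p)
    ⟨PadicAffine.centralizer_eq_bot_of_isOpen⟩

/-- **`Ex310TowerStatement` is satisfiable at a NON-EMPTY special-fibre certificate** (`K = ℚ̄`, the self-model over
`Aff(ℤ_3)`): the FACT-policy hypothesis `(h : Ex310TowerStatement Ω)` of the Ex. 3.10 consumers is consistent with a
certificate that actually certifies something.  Consistency evidence only. [cite: MochizukiSemiAnbd2006, Ex 3.10 p.44] -/
theorem Ex310TowerStatement.exists_nonvacuous :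
    ∃ (D : TemperedArithmeticGroup (AlgebraicClosure ℚ)) (S : SpecialFibreData D)
      (Ω : SpecialFibreOrigin (AlgebraicClosure ℚ)),
      Ω.IsSpecialFibreOf D S ∧ Ω.IsOfGeometricOrigin D ∧ Ex310TowerStatement Ω := by
  obtain ⟨D, S, Ω, h1, h2, -, -, h3⟩ :=
    @exists_specialFibreOrigin_ex310TowerStatement_padicAffine (AlgebraicClosure ℚ) _ _ 3 ⟨Nat.prime_three⟩
  exact ⟨D, S, Ω, h1, h2, h3⟩

end Literature.AnabelianGeometry.SemiGraphs

end
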